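import Summits.NavierStokesRegularity.NavierStokesRegularity.Theorems.PerpetualPumpThesisUniquenessFormBound
import Summits.NavierStokesRegularity.NavierStokesRegularity.Theorems.PerpetualPumpThesisUniquenessContinuity
import Summits.NavierStokesRegularity.NavierStokesRegularity.Theorems.PerpetualPumpThesisLocalExistenceStep

/-!
# Stub U (`uniqueness`) for `PerpetualPump.Thesis`: uniqueness of `H¹⁰_df`-mild solutions of the
# averaged Navier–Stokes equation

Final file of the stub `uniqueness` of line `SketchIdeator2` (crux stmt-NavierStokesRegularity-1832):
for an *arbitrary* averaging datum `𝒜` (T. Tao, J. Amer. Math. Soc. 29 (2016), arXiv:1402.0290v3,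
§1.1 (1.12)–(1.13); no symmetry, no cancellation), any datum class `a ∈ L²(ℝ³; ℂ³)` and any `T`,
two mild `H¹⁰_df` solutions (1.15) of `∂ₜu = Δu + B̃(u,u)` on `[0, T)` with the same datum coincide
(`stub_uniqueness`; Tao, p. 7: the standard local theory after (1.15)).

Proof (the `L²` energy method): restrict to a compact `[0, b] ⊂ [0, T)`, where `u`, `v` are
`H¹⁰`-bounded by some `M`. Testing the two Duhamel identities (1.15) at time `t` against the
admissible field `w = d(t) = u(t) - v(t) ∈ H¹⁰_df` and subtracting gives, by `⟨w, w⟩ = ‖w‖²` for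
real `w` and the splitting `⟨B̃(u,u), h⟩ - ⟨B̃(v,v), h⟩ = ⟨B̃(d,u), h⟩ + ⟨B̃(v,d), h⟩` (part II),
`‖d(t)‖² = ∫₀ᵗ ⟨B̃(d,u) + B̃(v,d), e^{(t-s)Δ} d(t)⟩ ds` (the integrands are continuous, part II, so
the interval integrals are honest). By the `L² × H¹⁰ × H¹` bound of part I and the parabolic
smoothing `‖e^{σΔ} w‖_{H¹} ≤ (1 + σ^{-1/2}) ‖w‖_{L²}` (`eFourierSobolevNorm_one_heat_le`) the
integrand is at most `2KM (1 + (t-s)^{-1/2}) ‖d(s)‖ ‖d(t)‖`, whence the Volterra inequality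
`‖d(t)‖ ≤ 2KM ∫_{t₀}^t (1 + (t-s)^{-1/2}) ‖d(s)‖ ds` whenever `d = 0` on `[0, t₀]`
(`norm_sub_le_step`). Since `∫₀^δ (1 + σ^{-1/2}) dσ → 0` as `δ → 0`, on each window
`[kδ, (k+1)δ]` the supremum of `‖d‖` is at most half of itself, hence zero; induction on `k`
(`eq_on_Icc`).

## References

* T. Tao, J. Amer. Math. Soc. 29 (2016), 601–674, arXiv:1402.0290v3, §1.1 (1.9), (1.12)–(1.15).
-/

noncomputable section

open MeasureTheory Set Filter Topology
open scoped ENNReal NNReal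

set_option linter.dupNamespace false

namespace Summit.NavierStokesRegularity.NavierStokesRegularity.Theorems.PerpetualPumpThesis.U

open Literature.Analysis.FluidPDE Literature.Analysis.FluidPDE.Tao2016
open Literature.Analysis.FunctionSpaces (eFourierSobolevNorm)

/-! ### Parabolic smoothing: `e^{σΔ}` maps `L²` into `H¹` with norm `≤ 1 + σ^{-1/2}` -/

/-- The pointwise symbol bound `(1+|ξ|²) |e^{-4π²σ|ξ|²}|² ≤ (1 + σ^{-1/2})²` for `σ > 0`. -/
theorem sobolevWeight_one_mul_norm_heatSymbol_sq_le {σ : ℝ} (hσ : 0 < σ) (ξ : EuclideanSpace ℝ (Fin 3)) :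
    (1 + ‖ξ‖ ^ 2) ^ (1 : ℝ) * ‖heatSymbol σ ξ‖ ^ 2 ≤ (1 + σ ^ (-(1 / 2 : ℝ))) ^ 2 := by
  have h := E.weight_half_mul_exp_le hσ (sq_nonneg ‖ξ‖)
  have hn : ‖heatSymbol σ ξ‖ = Real.exp (-(4 * Real.pi ^ 2 * σ * ‖ξ‖ ^ 2)) := by
    rw [heatSymbol, max_eq_left hσ.le, Complex.norm_real, Real.norm_of_nonneg (Real.exp_pos _).le]
  have h0 : 0 ≤ (1 + ‖ξ‖ ^ 2) ^ ((1 : ℝ) / 2) * Real.exp (-(4 * Real.pi ^ 2 * σ * ‖ξ‖ ^ 2)) := by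
    positivity
  have hsq : ((1 + ‖ξ‖ ^ 2) ^ ((1 : ℝ) / 2)) ^ 2 = (1 + ‖ξ‖ ^ 2) ^ (1 : ℝ) := by
    rw [Real.rpow_one, ← Real.sqrt_eq_rpow, Real.sq_sqrt (by positivity)]
  calc (1 + ‖ξ‖ ^ 2) ^ (1 : ℝ) * ‖heatSymbol σ ξ‖ ^ 2
      = ((1 + ‖ξ‖ ^ 2) ^ ((1 : ℝ) / 2) * Real.exp (-(4 * Real.pi ^ 2 * σ * ‖ξ‖ ^ 2))) ^ 2 := by
        rw [hn, mul_pow, hsq]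
    _ ≤ (1 + σ ^ (-(1 / 2 : ℝ))) ^ 2 := pow_le_pow_left₀ h0 h 2

/-- **Parabolic smoothing of the heat propagator**: `‖e^{σΔ} w‖_{H¹} ≤ (1 + σ^{-1/2}) ‖w‖_{L²}` for
`σ > 0` (the symbol bound `⟨ξ⟩ e^{-4π²σ|ξ|²} ≤ 1 + σ^{-1/2}` and Plancherel). -/
theorem eFourierSobolevNorm_one_heat_le {σ : ℝ} (hσ : 0 < σ) (w : L2C) :
    eFourierSobolevNorm 1 (heat σ w) ≤ ENNReal.ofReal (1 + σ ^ (-(1 / 2 : ℝ))) * ‖w‖ₑ := by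
  rw [eFourierSobolevNorm_eq]
  unfold sobolevWeightIntegral
  have hpt : ∀ᵐ ξ ∂(volume : Measure (EuclideanSpace ℝ (Fin 3))),
      ENNReal.ofReal ((1 + ‖ξ‖ ^ 2) ^ (1 : ℝ)) * ‖fourierFn (heat σ w) ξ‖ₑ ^ 2 ≤
        ENNReal.ofReal ((1 + σ ^ (-(1 / 2 : ℝ))) ^ 2) * ‖fourierFn w ξ‖ₑ ^ 2 := by
    filter_upwards [fourierFn_heat σ w] with ξ hξ
    rw [hξ, enorm_smul, mul_pow, ← mul_assoc]
    refine mul_le_mul' ?_ le_rfl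
    rw [← ofReal_norm, ← ENNReal.ofReal_pow (norm_nonneg _), ← ENNReal.ofReal_mul (by positivity)]
    exact ENNReal.ofReal_le_ofReal (sobolevWeight_one_mul_norm_heatSymbol_sq_le hσ ξ)
  calc (∫⁻ ξ, ENNReal.ofReal ((1 + ‖ξ‖ ^ 2) ^ (1 : ℝ)) * ‖fourierFn (heat σ w) ξ‖ₑ ^ 2) ^ (1 / 2 : ℝ)
      ≤ (∫⁻ ξ, ENNReal.ofReal ((1 + σ ^ (-(1 / 2 : ℝ))) ^ 2) * ‖fourierFn w ξ‖ₑ ^ 2) ^ (1 / 2 : ℝ) :=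
        ENNReal.rpow_le_rpow (lintegral_mono_ae hpt) (by norm_num)
    _ = ENNReal.ofReal (1 + σ ^ (-(1 / 2 : ℝ))) * ‖w‖ₑ := by
        rw [lintegral_const_mul' _ _ ENNReal.ofReal_ne_top, ENNReal.mul_rpow_of_nonneg _ _ (by norm_num),
          lintegral_enorm_sq_fourierFn_rpow_eq, ENNReal.ofReal_pow (by positivity),
          ← ENNReal.rpow_natCast, ← ENNReal.rpow_mul]
        norm_num

/-! ### The energy inequality for the difference of two mild solutions -/

/-- `‖x‖_{L²} ≤ M` when `‖x‖_{H¹⁰} ≤ M`. -/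
theorem norm_le_of_H10_le {x : L2C} {M : ℝ} (hM0 : 0 ≤ M)
    (hx : eFourierSobolevNorm 10 x ≤ ENNReal.ofReal M) : ‖x‖ ≤ M := by
  have h := (enorm_le_eFourierSobolevNorm (by norm_num : (0 : ℝ) ≤ 10) x).trans hx
  rwa [← ofReal_norm, ENNReal.ofReal_le_ofReal_iff hM0] at h

/-- **The `L²` bound for the difference of the two quadratic terms**: with the `L² × H¹⁰ × H¹`
constant `K` of part I, `‖x‖_{H¹⁰}, ‖y‖_{H¹⁰} ≤ M` and `‖h‖_{H¹} ≤ N`,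
`|⟨B̃(x,x), h⟩ - ⟨B̃(y,y), h⟩| ≤ 2 K M N ‖x - y‖_{L²}`. -/
theorem norm_form_sub_form_le (𝒜 : AveragingDatum) {K1 : ℝ≥0}
    (hK1 : ∀ f g h : L2C, eFourierSobolevNorm 10 g < ⊤ → eFourierSobolevNorm 1 h < ⊤ →
      ‖𝒜.form f g h‖ₑ ≤ (K1 : ℝ≥0∞) * ‖f‖ₑ * eFourierSobolevNorm 10 g * eFourierSobolevNorm 1 h ∧
      ‖𝒜.form g f h‖ₑ ≤ (K1 : ℝ≥0∞) * ‖f‖ₑ * eFourierSobolevNorm 10 g * eFourierSobolevNorm 1 h)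
    {x y h : L2C} {M N : ℝ} (hM0 : 0 ≤ M) (hN0 : 0 ≤ N)
    (hx : eFourierSobolevNorm 10 x ≤ ENNReal.ofReal M) (hy : eFourierSobolevNorm 10 y ≤ ENNReal.ofReal M)
    (hh : eFourierSobolevNorm 1 h ≤ ENNReal.ofReal N) :
    ‖𝒜.form x x h - 𝒜.form y y h‖ ≤ 2 * K1 * M * N * ‖x - y‖ := by
  have hxt : eFourierSobolevNorm 10 x < ⊤ := hx.trans_lt ENNReal.ofReal_lt_top
  have hyt : eFourierSobolevNorm 10 y < ⊤ := hy.trans_lt ENNReal.ofReal_lt_top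
  have hht : eFourierSobolevNorm 1 h < ⊤ := hh.trans_lt ENNReal.ofReal_lt_top
  have key : ∀ z : ℂ, ‖z‖ₑ ≤ (K1 : ℝ≥0∞) * ‖x - y‖ₑ * ENNReal.ofReal M * ENNReal.ofReal N →
      ‖z‖ ≤ K1 * M * N * ‖x - y‖ := by
    intro z hz
    have hfin : (K1 : ℝ≥0∞) * ‖x - y‖ₑ * ENNReal.ofReal M * ENNReal.ofReal N ≠ ⊤ :=
      ENNReal.mul_ne_top (ENNReal.mul_ne_top (ENNReal.mul_ne_top ENNReal.coe_ne_top enorm_ne_top)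
        ENNReal.ofReal_ne_top) ENNReal.ofReal_ne_top
    have h' := ENNReal.toReal_mono hfin hz
    rw [toReal_enorm, ENNReal.toReal_mul, ENNReal.toReal_mul, ENNReal.toReal_mul, ENNReal.coe_toReal,
      toReal_enorm, ENNReal.toReal_ofReal hM0, ENNReal.toReal_ofReal hN0] at h'
    exact h'.trans_eq (by ring)
  have h1 : ‖𝒜.form (x - y) x h‖ ≤ K1 * M * N * ‖x - y‖ := key _
    (((hK1 (x - y) x h hxt hht).1).trans (mul_le_mul' (mul_le_mul' le_rfl hx) hh))
  have h2 : ‖𝒜.form y (x - y) h‖ ≤ K1 * M * N * ‖x - y‖ := key _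
    (((hK1 (x - y) y h hyt hht).2).trans (mul_le_mul' (mul_le_mul' le_rfl hy) hh))
  rw [form_sub_form 𝒜 h hxt hyt]
  calc ‖𝒜.form (x - y) x h + 𝒜.form y (x - y) h‖
      ≤ ‖𝒜.form (x - y) x h‖ + ‖𝒜.form y (x - y) h‖ := norm_add_le _ _
    _ ≤ K1 * M * N * ‖x - y‖ + K1 * M * N * ‖x - y‖ := add_le_add h1 h2
    _ = 2 * K1 * M * N * ‖x - y‖ := by ring

/-- **Two mild solutions with the same datum agree at time `0`** (the datum is attained in
`(H¹⁰_df)*`, and `u(0) - v(0)` is itself an admissible test field). -/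
theorem eq_of_initial {T : L2C → L2C → L2C → ℂ} {a : L2C} {I : Set ℝ} {u v : ℝ → L2C}
    (hu : IsMildSolutionFor T a I u) (hv : IsMildSolutionFor T a I v) (h0 : (0 : ℝ) ∈ I) :
    u 0 = v 0 := by
  have hw : MemH10df (u 0 - v 0) := (hu.1 0 h0).sub (hv.1 0 h0)
  have h3 : pairing (u 0 - v 0) (u 0 - v 0) = 0 := by
    rw [pairing_sub_left, hu.initial h0 hw, hv.initial h0 hw, sub_self]
  rw [pairing_self hw.2.1] at h3
  have h4 : ‖u 0 - v 0‖ ^ 2 = 0 := by exact_mod_cast h3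
  exact sub_eq_zero.1 (norm_eq_zero.1 (pow_eq_zero_iff two_ne_zero |>.1 h4))

/-- **The Volterra inequality for the difference of two mild solutions** on `[0, b]`: if `u`, `v`
are mild solutions with the same datum, `H¹⁰`-bounded by `M`, and `d = u - v` vanishes on
`[0, t₀]` and is bounded by `Bd` in `L²` on `[t₀, t]`, then
`‖d(t)‖ ≤ 2 K M · Bd · ∫₀^{t-t₀} (1 + σ^{-1/2}) dσ`
(energy identity tested against `w = d(t)`, the `L² × H¹⁰ × H¹` bound, parabolic smoothing). -/
theorem norm_sub_le_step (𝒜 : AveragingDatum) {K1 : ℝ≥0}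
    (hK1 : ∀ f g h : L2C, eFourierSobolevNorm 10 g < ⊤ → eFourierSobolevNorm 1 h < ⊤ →
      ‖𝒜.form f g h‖ₑ ≤ (K1 : ℝ≥0∞) * ‖f‖ₑ * eFourierSobolevNorm 10 g * eFourierSobolevNorm 1 h ∧
      ‖𝒜.form g f h‖ₑ ≤ (K1 : ℝ≥0∞) * ‖f‖ₑ * eFourierSobolevNorm 10 g * eFourierSobolevNorm 1 h)
    {a : L2C} {b : ℝ} {u v : ℝ → L2C} (hu : IsMildSolutionFor 𝒜.form a (Icc 0 b) u)
    (hv : IsMildSolutionFor 𝒜.form a (Icc 0 b) v) {M : ℝ} (hM0 : 0 ≤ M)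
    (hMu : ∀ s ∈ Icc 0 b, eFourierSobolevNorm 10 (u s) ≤ ENNReal.ofReal M)
    (hMv : ∀ s ∈ Icc 0 b, eFourierSobolevNorm 10 (v s) ≤ ENNReal.ofReal M)
    {t₀ t : ℝ} (ht₀ : 0 ≤ t₀) (ht₀t : t₀ ≤ t) (htb : t ≤ b) {Bd : ℝ} (hBd : 0 ≤ Bd)
    (h0 : ∀ s ∈ Icc 0 t₀, u s = v s) (hB : ∀ s ∈ Icc t₀ t, ‖u s - v s‖ ≤ Bd) :
    ‖u t - v t‖ ≤ 2 * K1 * M * Bd * |∫ σ in (0 : ℝ)..(t - t₀), (1 + σ ^ (-(1 / 2 : ℝ)))| := by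
  have ht : t ∈ Icc 0 b := ⟨ht₀.trans ht₀t, htb⟩
  have h0b : (0 : ℝ) ∈ Icc 0 b := ⟨le_rfl, ht.1.trans ht.2⟩
  have ht₀b : t₀ ∈ Icc 0 b := ⟨ht₀, ht₀t.trans htb⟩
  set w : L2C := u t - v t with hw_def
  have hw : MemH10df w := (hu.1 t ht).sub (hv.1 t ht)
  -- the two Duhamel integrands
  set Fu : ℝ → ℂ := fun s => 𝒜.form (u s) (u s) (heat (t - s) w) with hFu
  set Fv : ℝ → ℂ := fun s => 𝒜.form (v s) (v s) (heat (t - s) w) with hFv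
  have hcu : ContinuousOn Fu (Icc 0 b) := continuousOn_form_heat 𝒜 hu.2.1 hMu w t
  have hcv : ContinuousOn Fv (Icc 0 b) := continuousOn_form_heat 𝒜 hv.2.1 hMv w t
  have hcG : ContinuousOn (fun s => Fu s - Fv s) (Icc 0 b) := hcu.sub hcv
  have hint : ∀ {t₁ t₂ : ℝ}, t₁ ∈ Icc 0 b → t₂ ∈ Icc 0 b → ∀ {F : ℝ → ℂ}, ContinuousOn F (Icc 0 b) →
      IntervalIntegrable F volume t₁ t₂ :=
    fun h₁ h₂ _ hF => (hF.mono (uIcc_subset_Icc h₁ h₂)).intervalIntegrable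
  -- the integrand vanishes on `[0, t₀]`
  have hvanish : ∫ s in (0 : ℝ)..t₀, (Fu s - Fv s) = 0 := by
    rw [intervalIntegral.integral_congr (g := fun _ => (0 : ℂ)) ?_, intervalIntegral.integral_zero]
    intro s hs
    rw [uIcc_of_le ht₀] at hs
    show Fu s - Fv s = 0
    simp only [hFu, hFv, h0 s hs, sub_self]
  -- the energy identity `‖w‖² = ∫_{t₀}^t (Fu - Fv)`
  have eu : pairing (u t) w = pairing (heat t a) w + ∫ s in (0 : ℝ)..t, Fu s := hu.2.2 t ht w hw
  have ev : pairing (v t) w = pairing (heat t a) w + ∫ s in (0 : ℝ)..t, Fv s := hv.2.2 t ht w hw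
  have hId : ((‖w‖ ^ 2 : ℝ) : ℂ) = ∫ s in t₀..t, (Fu s - Fv s) := by
    calc ((‖w‖ ^ 2 : ℝ) : ℂ) = pairing w w := (pairing_self hw.2.1).symm
      _ = pairing (u t) w - pairing (v t) w := by rw [hw_def, pairing_sub_left]
      _ = (∫ s in (0 : ℝ)..t, Fu s) - ∫ s in (0 : ℝ)..t, Fv s := by rw [eu, ev]; ring
      _ = ∫ s in (0 : ℝ)..t, (Fu s - Fv s) :=
          (intervalIntegral.integral_sub (hint h0b ht hcu) (hint h0b ht hcv)).symm
      _ = (∫ s in (0 : ℝ)..t₀, (Fu s - Fv s)) + ∫ s in t₀..t, (Fu s - Fv s) :=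
          (intervalIntegral.integral_add_adjacent_intervals (hint h0b ht₀b hcG) (hint ht₀b ht hcG)).symm
      _ = ∫ s in t₀..t, (Fu s - Fv s) := by rw [hvanish, zero_add]
  -- pointwise bound on the integrand off the endpoint `s = t`
  set c : ℝ := 2 * K1 * M * ‖w‖ * Bd with hc
  have hc0 : 0 ≤ c := by positivity
  have hpt : ∀ᵐ s ∂(volume : Measure ℝ), s ∈ Ioc t₀ t →
      ‖Fu s - Fv s‖ ≤ c * (1 + (t - s) ^ (-(1 / 2 : ℝ))) := by
    filter_upwards [Measure.ae_ne volume t] with s hst hs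
    have hslt : s < t := lt_of_le_of_ne hs.2 hst
    have hσ : 0 < t - s := sub_pos.2 hslt
    have hs0b : s ∈ Icc 0 b := ⟨ht₀.trans hs.1.le, hs.2.trans htb⟩
    have hN : eFourierSobolevNorm 1 (heat (t - s) w) ≤
        ENNReal.ofReal ((1 + (t - s) ^ (-(1 / 2 : ℝ))) * ‖w‖) := by
      rw [ENNReal.ofReal_mul (by positivity), ofReal_norm]
      exact eFourierSobolevNorm_one_heat_le hσ w
    have hG := norm_form_sub_form_le 𝒜 hK1 hM0 (by positivity) (hMu s hs0b) (hMv s hs0b) hN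
    calc ‖Fu s - Fv s‖ ≤ 2 * K1 * M * ((1 + (t - s) ^ (-(1 / 2 : ℝ))) * ‖w‖) * ‖u s - v s‖ := hG
      _ ≤ 2 * K1 * M * ((1 + (t - s) ^ (-(1 / 2 : ℝ))) * ‖w‖) * Bd :=
          mul_le_mul_of_nonneg_left (hB s ⟨hs.1.le, hs.2⟩) (by positivity)
      _ = c * (1 + (t - s) ^ (-(1 / 2 : ℝ))) := by rw [hc]; ring
  -- integrate
  have hgi : IntervalIntegrable (fun s => c * (1 + (t - s) ^ (-(1 / 2 : ℝ)))) volume t₀ t := by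
    have h := (E.intervalIntegrable_one_add_rpow (t - t₀) 0).comp_sub_left t
    rw [sub_sub_cancel, sub_zero] at h
    exact h.const_mul c
  have hnorm : ‖w‖ ^ 2 ≤ c * |∫ σ in (0 : ℝ)..(t - t₀), (1 + σ ^ (-(1 / 2 : ℝ)))| := by
    have h1 := intervalIntegral.norm_integral_le_of_norm_le ht₀t hpt hgi
    rw [← hId, Complex.norm_real, Real.norm_of_nonneg (sq_nonneg _),
      intervalIntegral.integral_const_mul] at h1
    refine h1.trans (mul_le_mul_of_nonneg_left ?_ hc0)
    have h2 := intervalIntegral.integral_comp_sub_left (fun σ => 1 + σ ^ (-(1 / 2 : ℝ))) t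
      (a := t₀) (b := t)
    simp only [sub_self] at h2
    rw [h2]
    exact le_abs_self _
  -- divide by `‖w‖`
  by_cases hw0 : ‖w‖ = 0
  · rw [hw0]; positivity
  · have hwpos : 0 < ‖w‖ := (norm_nonneg _).lt_of_ne (Ne.symm hw0)
    have h2 : ‖w‖ * ‖w‖ ≤
        ‖w‖ * (2 * K1 * M * Bd * |∫ σ in (0 : ℝ)..(t - t₀), (1 + σ ^ (-(1 / 2 : ℝ)))|) := by
      rw [← sq, hc] at *
      convert hnorm using 1
      ring
    exact le_of_mul_le_mul_left h2 hwpos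

/-! ### Uniqueness on compact intervals by stepping -/

/-- **Uniqueness of mild `H¹⁰_df` solutions on a compact interval `[0, b]`** for an arbitrary
averaging datum: the Volterra inequality with a kernel of vanishing short-time mass forces
`d = u - v` to vanish on successive windows `[kδ, (k+1)δ]`. -/
theorem eq_on_Icc (𝒜 : AveragingDatum) {a : L2C} {b : ℝ} {u v : ℝ → L2C}
    (hu : IsMildSolutionFor 𝒜.form a (Icc 0 b) u) (hv : IsMildSolutionFor 𝒜.form a (Icc 0 b) v) :
    ∀ t ∈ Icc 0 b, u t = v t := by
  obtain ⟨K1, hK1⟩ := exists_enorm_form_le_one 𝒜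
  obtain ⟨Mu, hMu⟩ := ContinuousInH10On.exists_bound hu.2.1 fun s hs => (hu.1 s hs).1
  obtain ⟨Mv, hMv⟩ := ContinuousInH10On.exists_bound hv.2.1 fun s hs => (hv.1 s hs).1
  set M : ℝ := max (max Mu Mv) 0 with hM
  have hM0 : 0 ≤ M := le_max_right _ _
  have hMu' : ∀ s ∈ Icc 0 b, eFourierSobolevNorm 10 (u s) ≤ ENNReal.ofReal M := fun s hs => by
    rw [← ENNReal.ofReal_toReal (hu.1 s hs).1.ne]
    exact ENNReal.ofReal_le_ofReal ((hMu s hs).trans ((le_max_left _ _).trans (le_max_left _ _)))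
  have hMv' : ∀ s ∈ Icc 0 b, eFourierSobolevNorm 10 (v s) ≤ ENNReal.ofReal M := fun s hs => by
    rw [← ENNReal.ofReal_toReal (hv.1 s hs).1.ne]
    exact ENNReal.ofReal_le_ofReal ((hMv s hs).trans ((le_max_right _ _).trans (le_max_left _ _)))
  -- the crude `L²` bound on the difference
  have hcrude : ∀ s ∈ Icc 0 b, ‖u s - v s‖ ≤ 2 * M := fun s hs =>
    (norm_sub_le _ _).trans (by
      linarith [norm_le_of_H10_le hM0 (hMu' s hs), norm_le_of_H10_le hM0 (hMv' s hs)])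
  -- the step length
  set C : ℝ := 2 * K1 * M with hC
  have hC0 : 0 ≤ C := by positivity
  obtain ⟨δ, hδ, -, hδη⟩ := E.exists_clock_bound (η := 1 / (2 * (C + 1))) (by positivity)
  have hstep : C * (1 / (2 * (C + 1))) ≤ 1 / 2 := by
    rw [mul_one_div, div_le_iff₀ (by positivity)]
    linarith
  -- induction on the windows `[kδ, (k+1)δ]`
  have key : ∀ k : ℕ, ∀ s ∈ Icc 0 b, s ≤ k * δ → u s = v s := by
    intro k
    induction k with
    | zero =>
      intro s hs hsk
      rw [Nat.cast_zero, zero_mul] at hsk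
      have hs0 : s = 0 := le_antisymm hsk hs.1
      rw [hs0]
      exact eq_of_initial hu hv ⟨le_rfl, hs.1.trans hs.2⟩
    | succ k ih =>
      have hkδ : 0 ≤ (k : ℝ) * δ := by positivity
      -- halving the bound on the new window, `n` times
      have inner : ∀ n : ℕ, ∀ t ∈ Icc 0 b, t ≤ ((k + 1 : ℕ) : ℝ) * δ → ‖u t - v t‖ ≤ 2 * M / 2 ^ n := by
        intro n
        induction n with
        | zero =>
          intro t ht _
          rw [pow_zero, div_one]
          exact hcrude t ht
        | succ n ihn =>
          intro t ht htk
          by_cases htk' : t ≤ k * δ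
          · rw [ih t ht htk', sub_self, norm_zero]
            positivity
          · have htk'' : (k : ℝ) * δ < t := not_le.1 htk'
            have hBd : 0 ≤ 2 * M / 2 ^ n := by positivity
            have h := norm_sub_le_step 𝒜 hK1 hu hv hM0 hMu' hMv' hkδ htk''.le ht.2 hBd
              (fun s hs => ih s ⟨hs.1, hs.2.trans (htk''.le.trans ht.2)⟩ hs.2)
              (fun s hs => ihn s ⟨hkδ.trans hs.1, hs.2.trans ht.2⟩ (hs.2.trans htk))
            have hr : t - k * δ ∈ Icc 0 δ := by
              refine ⟨sub_nonneg.2 htk''.le, ?_⟩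
              push_cast at htk
              linarith
            have hI := hδη (t - k * δ) hr
            calc ‖u t - v t‖
                ≤ 2 * K1 * M * (2 * M / 2 ^ n) * |∫ σ in (0 : ℝ)..(t - k * δ), (1 + σ ^ (-(1 / 2 : ℝ)))| := h
              _ ≤ 2 * K1 * M * (2 * M / 2 ^ n) * (1 / (2 * (C + 1))) := by gcongr
              _ = (2 * M / 2 ^ n) * (C * (1 / (2 * (C + 1)))) := by rw [hC]; ring
              _ ≤ (2 * M / 2 ^ n) * (1 / 2) := mul_le_mul_of_nonneg_left hstep hBd
              _ = 2 * M / 2 ^ (n + 1) := by rw [pow_succ]; ring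
      intro s hs hsk
      have hlim : Tendsto (fun n : ℕ => 2 * M / 2 ^ n) atTop (𝓝 0) :=
        tendsto_const_nhds.div_atTop (tendsto_pow_atTop_atTop_of_one_lt one_lt_two)
      have hle : ‖u s - v s‖ ≤ 0 := ge_of_tendsto' hlim fun n => inner n s hs hsk
      exact sub_eq_zero.1 (norm_le_zero_iff.1 hle)
  intro t ht
  obtain ⟨k, hk⟩ := exists_nat_ge (t / δ)
  exact key k t ht ((div_le_iff₀ hδ).1 hk)

end Summit.NavierStokesRegularity.NavierStokesRegularity.Theorems.PerpetualPumpThesis.U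

namespace Summit.NavierStokesRegularity.NavierStokesRegularity.Theorems.PerpetualPumpThesis

open Literature.Analysis.FluidPDE Literature.Analysis.FluidPDE.Tao2016
open Literature.Analysis.FunctionSpaces

/-- **Stub U (`uniqueness`) of line `SketchIdeator2`: uniqueness of `H¹⁰_df`-mild solutions of the
averaged Navier–Stokes equation.** For every averaging datum `𝒜` (Tao 2016, (1.12)–(1.13); no
symmetry or cancellation needed), every datum class `a ∈ L²(ℝ³; ℂ³)` and every `T`, two mild
solutions (1.15) of `∂ₜu = Δu + B̃(u,u)` with datum `a` on `[0, T)` agree on `[0, T)` (vacuous for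
`T ≤ 0`). Proof: `L²`-energy inequality for the difference tested against itself, parabolic
smoothing, and a Volterra/Grönwall stepping argument on compact sub-intervals (`U.eq_on_Icc`). -/
theorem stub_uniqueness :
    ∀ 𝒜 : AveragingDatum, ∀ (a : L2C) (T : ℝ) (u v : ℝ → L2C),
      IsMildSolutionFor 𝒜.form a (Ico 0 T) u → IsMildSolutionFor 𝒜.form a (Ico 0 T) v →
      ∀ t ∈ Ico 0 T, u t = v t := by
  intro 𝒜 a T u v hu hv t ht
  have hsub : Icc 0 t ⊆ Ico 0 T := fun s hs => ⟨hs.1, lt_of_le_of_lt hs.2 ht.2⟩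
  exact U.eq_on_Icc 𝒜 (hu.mono hsub) (hv.mono hsub) t ⟨ht.1, le_rfl⟩

end Summit.NavierStokesRegularity.NavierStokesRegularity.Theorems.PerpetualPumpThesis
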